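import Mathlib

/-!
# P8ClassIdent8Basic — the tools of the PART 3 class-identification certificate (cell pub-hodge-repro0, seat p8 (g6))

Permutations of `Fin 8` from explicit tables (`mkP`), words in a finite family of generators (`wordEval`), membership of a word
in the generated subgroup (`wordEval_mem`, `mem_of_eq_word`), and the conjugation criterion `closure_conj_eq`: if `r` conjugates
every generator of `S` into `closure T` and `r⁻¹` every generator of `T` into `closure S`, then
`closure S = (closure T).map (MulAut.conj r⁻¹)`, i.e. the two generated subgroups are conjugate by `r`. Used by
`P8ClassIdent8A`–`P8ClassIdent8D` (the 50 classes) and `P8ClassIdent8` (the bijection of record); see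
proofs/p8-Dim8SecondPath-v1.4.md §20(b) and STATUS l.2427 (3)(ii).
-/

namespace HodgeRepro0.P8ClassIdent8

/-- the symmetric group on the 8 ι-pairs of the simple eightfold -/
abbrev P := Equiv.Perm (Fin 8)

/-- an explicit permutation of `Fin 8` from its value table and the table of its inverse -/
def mkP (f g : Fin 8 → Fin 8) (h1 : Function.LeftInverse g f) (h2 : Function.RightInverse g f) : P := ⟨f, g, h1, h2⟩

/-- the value of a word `[(i₁, b₁), …]` in the generators `gens`: `gens i₁ ^ (±1) * …` (`b = true` = the inverse) -/
def wordEval {m : ℕ} (gens : Fin m → P) : List (Fin m × Bool) → P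
  | [] => 1
  | (i, false) :: w => gens i * wordEval gens w
  | (i, true) :: w => (gens i)⁻¹ * wordEval gens w

/-- a word in the generators lies in the subgroup they generate -/
theorem wordEval_mem {m : ℕ} (gens : Fin m → P) (w : List (Fin m × Bool)) :
    wordEval gens w ∈ Subgroup.closure (Set.range gens) := by
  induction w with
  | nil => exact Subgroup.one_mem _
  | cons x w ih =>
    rcases x with ⟨i, b⟩
    cases b
    · exact Subgroup.mul_mem _ (Subgroup.subset_closure ⟨i, rfl⟩) ih
    · exact Subgroup.mul_mem _ (Subgroup.inv_mem _ (Subgroup.subset_closure ⟨i, rfl⟩)) ih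

/-- an element equal to a word in the generators lies in the subgroup they generate -/
theorem mem_of_eq_word {m : ℕ} (gens : Fin m → P) (x : P) (w : List (Fin m × Bool)) (h : x = wordEval gens w) :
    x ∈ Subgroup.closure (Set.range gens) := h ▸ wordEval_mem gens w

/-- if `r` conjugates every generator of `S` into `closure T` and `r⁻¹` conjugates every generator of `T` into
`closure S`, then `closure S = r⁻¹ (closure T) r` -/
theorem closure_conj_eq {G : Type*} [Group G] (S T : Set G) (r : G)
    (h1 : ∀ g ∈ S, r * g * r⁻¹ ∈ Subgroup.closure T)
    (h2 : ∀ t ∈ T, r⁻¹ * t * r ∈ Subgroup.closure S) :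
    Subgroup.closure S = (Subgroup.closure T).map (MulAut.conj r⁻¹).toMonoidHom := by
  apply le_antisymm
  · rw [Subgroup.closure_le]
    intro g hg
    refine ⟨r * g * r⁻¹, h1 g hg, ?_⟩
    simp [mul_assoc]
  · rw [Subgroup.map_le_iff_le_comap, Subgroup.closure_le]
    intro t ht
    show (MulAut.conj r⁻¹) t ∈ Subgroup.closure S
    rw [MulAut.conj_apply, inv_inv]
    exact h2 t ht

end HodgeRepro0.P8ClassIdent8
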